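import Summits.CriticalPhenomena.SAWScalingLimit.Theorems.CriticalBubbleBound.Negative.CriticalBubbleBoundUnrootedPolygons
import Literature.Probability.RandomPlanarGeometry.SAWBridges

/-!
# Objects of the line `kesten-product-renewal-dictionary` for the crux `SAWTotalPositivity.CriticalBubbleBound`
(stmt-CriticalPhenomena-7117; lead prover, crux protocol; skeleton
`Summits/CriticalPhenomena/SAWScalingLimit/Cruxes/CriticalBubbleBound/Lines/kesten-product-renewal-dictionary.lean`)

By the landed polygon normal form (`Negative.criticalBubbleBound_iff_polygonSeries_ne_top`) the crux is the
finiteness of ONE series, `polygonSeries = Σ_N N q_N x_c^N` (critical self-avoiding polygons of `ℤ²` up to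
translation, weighted by their length). The line cuts every polygon class into a pair of BRIDGES
(Madras–Slade Def. 1.2.4) meeting at a common apex, and reads `x_c`-weighted bridge sums as expectations
under Kesten's critical renewal measure (Madras–Slade §4.2, (4.2.4): `Σ_{irreducible β} x_c^{|β|} = 1`).
This file only DEFINES the objects the line's stubs speak about — no statement of the line is asserted here:

* `Bridge` — a bridge of `ℤ²` from the origin of any length (`Σ n, Zd.bridges 2 n`), with `len`, `fn`,
  `tip`, `span` (= first coordinate of the endpoint, the renewal LEVEL reached) and `mass = x_c^{|W|}`;
* `columnMass h` — `u_h = B_h(x_c) = Σ_{span W = h} x_c^{|W|}` (renewal density at level `h`);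
* `pinnedLengthMass v` — `L(v) = Σ_{tip W = v} |W| x_c^{|W|}` (length-weighted pinned bridge mass);
* `BridgePair`, `ApexMeet`, `AtHeight`, `OnlyApex`, `pairWeight`, `freePairMass h` (`F(h)`),
  `disjointPairMass h` (`M₂(h)`) — pairs `(W₁, W₂)` with `W₂` thought of as translated by `e₁ = (0,1)`,
  meeting at a common apex in column `h`, vertex-disjoint except there, weighted by
  `(|W₁| + |W₂|) x_c^{|W₁| + |W₂|}`.

Sources: N. Madras, G. Slade, *The Self-Avoiding Walk* (1993), Definition 1.2.4 (bridges), §4.2 (Kesten's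
renewal structure), Definition 3.2.2 (polygons up to translation); H. Kesten, *On the number of self-avoiding
walks*, J. Math. Phys. 4 (1963), §4. Deliberately NOT here: the line's statements (two-bridge cut, Kesten's
bound `u_h ≤ 1`, the two open exponent bounds) — they live in the stub files and the reduction file.
-/

noncomputable section

open Literature.Probability.LatticeModels
open Literature.Probability.RandomPlanarGeometry Literature.Probability.RandomPlanarGeometry.SAW
open scoped ENNReal NNReal BigOperators

namespace Summit.CriticalPhenomena.SAWScalingLimit.Theorems.CriticalBubbleBound.Kesten

/-! ## Bridges of any length, their span and critical mass -/

/-- The transverse unit vector `e₁ = (0,1)` of `ℤ²` (bridges advance in coordinate `0`). [folklore] -/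
def eUp : Site 2 := ![0, 1]

/-- `(eUp) 0 = 0`. [folklore] -/
@[simp] theorem eUp_zero : eUp 0 = 0 := rfl

/-- `(eUp) 1 = 1`. [folklore] -/
@[simp] theorem eUp_one : eUp 1 = 1 := rfl

/-- A **bridge of `ℤ²` from the origin, of any length**: `⟨n, ω⟩` with `ω ∈ Zd.bridges 2 n` (an `n`-step
self-avoiding walk from `0`, frozen after time `n`, whose first coordinate is strictly above the start
after time `0` and maximal at the end). Under Kesten's critical renewal measure the event "some renewal
prefix equals `W`" has probability `x_c^{|W|}`. [cite: MadrasSlade1993, Definition 1.2.4] -/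
abbrev Bridge : Type := Σ n : ℕ, ↥(Zd.bridges 2 n)

namespace Bridge

/-- Number of steps `|W|`. [cite: MadrasSlade1993, Definition 1.2.4] -/
abbrev len (W : Bridge) : ℕ := W.1

/-- The vertex function of the bridge (`ℕ → ℤ²`, frozen after `|W|`). [cite: MadrasSlade1993, Definition 1.2.4] -/
abbrev fn (W : Bridge) : ℕ → Site 2 := W.2.1

/-- The endpoint (apex) `W(|W|)`. [cite: MadrasSlade1993, Definition 1.2.4] -/
abbrev tip (W : Bridge) : Site 2 := W.fn W.len

/-- The **span**: first coordinate of the endpoint (the renewal level reached). [cite: MadrasSlade1993, Definition 1.2.4] -/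
abbrev span (W : Bridge) : ℤ := W.tip 0

/-- The critical weight `x_c^{|W|}` in `ℝ≥0∞`. [cite: MadrasSlade1993, §4.2] -/
abbrev mass (W : Bridge) : ℝ≥0∞ := ENNReal.ofReal (criticalFugacity ^ W.len)

/-- The vertex function of a bridge is an element of `Zd.saws 2 |W|` and satisfies `Zd.IsBridge`. [cite: MadrasSlade1993, Definition 1.2.4] -/
theorem mem_saws_isBridge (W : Bridge) : W.fn ∈ Zd.saws 2 W.len ∧ Zd.IsBridge W.len W.fn :=
  Zd.mem_bridges.1 W.2.2

/-- A bridge starts at the origin. [cite: MadrasSlade1993, Definition 1.2.4] -/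
theorem fn_zero (W : Bridge) : W.fn 0 = 0 := (Zd.mem_saws.1 W.mem_saws_isBridge.1).1

/-- The span of a bridge is non-negative (it is `0` for the empty bridge and `≥ 1` otherwise). [cite: MadrasSlade1993, Definition 1.2.4] -/
theorem span_nonneg (W : Bridge) : 0 ≤ W.span := by
  rcases Nat.eq_zero_or_pos W.len with h0 | hpos
  · have : W.tip = W.fn 0 := by rw [Bridge.tip, h0]
    rw [Bridge.span, this, W.fn_zero]
    rfl
  · have hb := W.mem_saws_isBridge.2 W.len hpos le_rfl
    have h00 : W.fn 0 0 = 0 := by rw [W.fn_zero]; rfl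
    have := hb.1.le.trans hb.2
    rw [h00] at this
    exact this

/-- The critical weight of a bridge is finite. [folklore] -/
theorem mass_ne_top (W : Bridge) : W.mass ≠ ⊤ := ENNReal.ofReal_ne_top

end Bridge

/-! ## One-bridge masses: renewal density and pinned length-weighted mass -/

open Classical in
/-- **`u_h = B_h(x_c)`** — the critical mass of bridges of span `h`, `Σ_{W : span W = h} x_c^{|W|}`: under
Kesten's measure the probability that the renewal walk renews at level `h`. [cite: MadrasSlade1993, §4.2] -/
def columnMass (h : ℕ) : ℝ≥0∞ := ∑' W : Bridge, if W.span = h then W.mass else 0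

open Classical in
/-- **`L(v)`** — the length-weighted critical mass of bridges pinned at the site `v`,
`Σ_{W : tip W = v} |W| x_c^{|W|}` (the length-weighted Green's function of the renewal walk). [cite: MadrasSlade1993, §4.2] -/
def pinnedLengthMass (v : Site 2) : ℝ≥0∞ :=
  ∑' W : Bridge, if W.tip = v then (W.len : ℝ≥0∞) * W.mass else 0

/-! ## Pairs of bridges meeting at a common apex -/

/-- An ordered pair of bridges from the origin; the second one is thought of as translated by `e₁`
(so that it starts at `(0,1)`). [folklore] -/
abbrev BridgePair : Type := Bridge × Bridge

/-- The two bridges `W₁` and `W₂ + e₁` end at the same site (common apex). [folklore] -/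
def ApexMeet (p : BridgePair) : Prop := p.1.tip = p.2.tip + eUp

/-- The common apex lies in column `h`. [folklore] -/
def AtHeight (h : ℕ) (p : BridgePair) : Prop := p.1.span = h

/-- `W₁` and `W₂ + e₁` are vertex-disjoint except at their common endpoint. [folklore] -/
def OnlyApex (p : BridgePair) : Prop :=
  ∀ i ≤ p.1.len, ∀ j ≤ p.2.len, p.1.fn i = p.2.fn j + eUp → i = p.1.len ∧ j = p.2.len

/-- The length-weighted pair weight `(|W₁| + |W₂|) · x_c^{|W₁|} x_c^{|W₂|}`. [folklore] -/
def pairWeight (p : BridgePair) : ℝ≥0∞ := ((p.1.len : ℝ≥0∞) + p.2.len) * (p.1.mass * p.2.mass)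

open Classical in
/-- **`F(h)`** — the free (Kesten ⊗ Kesten, no avoidance constraint) length-weighted mass of bridge pairs
meeting at a common apex in column `h`. [folklore] -/
def freePairMass (h : ℕ) : ℝ≥0∞ :=
  ∑' p : BridgePair, if ApexMeet p ∧ AtHeight h p then pairWeight p else 0

open Classical in
/-- **`M₂(h)`** — the same mass restricted to pairs that are disjoint except at the apex (it carries the
image of the critical polygon classes under the lexicographic two-bridge cut). [folklore] -/
def disjointPairMass (h : ℕ) : ℝ≥0∞ :=
  ∑' p : BridgePair, if ApexMeet p ∧ AtHeight h p ∧ OnlyApex p then pairWeight p else 0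

/-- `M₂(h) ≤ F(h)`: the avoidance constraint only removes mass (the trivial disjointness gain, exponent `0`;
registered infrastructure sub-goal of the line, carried by this shared definitions file). [folklore] -/
theorem disjointPairMass_le_freePairMass : ∀ h : ℕ, disjointPairMass h ≤ freePairMass h := by
  classical
  intro h
  refine ENNReal.tsum_le_tsum fun p => ?_
  by_cases hp : ApexMeet p ∧ AtHeight h p ∧ OnlyApex p
  · rw [if_pos hp, if_pos ⟨hp.1, hp.2.1⟩]
  · rw [if_neg hp]
    exact zero_le

end Summit.CriticalPhenomena.SAWScalingLimit.Theorems.CriticalBubbleBound.Kesten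

end
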